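import Mathlib
import Summits.HodgeConjecture.FermatCycles.HodgeFermatCorollaryUPrime
import Summits.HodgeConjecture.FermatCycles.HodgeFermatLemmaWk

/-!
# COROLLARY U′ with a VARIABLE threshold `k` — the multiset side, from LEMMA W_{2k} (`HodgeFermat/CorollaryUSharp.lean`; HF-G27b)

Tree copy of the module `HodgeFermat/CorollaryUSharp.lean` of the sibling cell's standalone package
`run/shared/lean/pub/pub-hodgefermat/lean/HodgeFermat/` (252 lines, sha256 `fc65dc100004b6ff…`), source lines 31–139 and 144–247
(`EvenAtK`, `evenAtK_six_iff`, `evenAtK_mono`, `evenAtK_of_lemmaWk` — weight form —, `count_neg_eq_count_of_lemmaWk`, `isSumOfPairs_of_lemmaWk`,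
`isSumOfPairs_odd` — multiset form at every odd level under `1 < N → LemmaWk N (2k)` —, `reach_odd`) — pub-hodgefermat `CERT.md` l.915,
GATE HF-G27b; cell record `check/CorUSharp_standalone.lean` (hub `lean check` rc 0, `--axioms …isSumOfPairs_odd` = the trio).
Filed by cell `pub-hfermat`, seat prover-1 gen-5, on the COORDINATOR KEEPER RULING of 2026-08-25 (gem sweep H1: take the
off-gate kernel theorem `thmFstar` through the gate; every form of THEOREM F* is on-gate since 2026-08-25/26, gen-0/2/3/4), as
successor work of the same verbatim-port kind: the sibling's off-gate gate records HF-G27 / HF-G27b / HF-G27c — COROLLARY U′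
(all-unit Hodge multisets with few distinct residues are sums of pairs), its printed-threshold forms U♯, and THEOREM U in
shared-entry form — on top of the landed LEMMA W / THEOREM U / U⁺ / U⁼ chain (`HodgeFermatTheoremU.lean`,
`HodgeFermatLemmaWFourier.lean`, `HodgeFermatTheoremUPlus.lean`, `HodgeFermatTheoremUEq.lean`, `HodgeFermatPropDPrimeNFinal.lean`).
Deviations from the source module, exhaustively: the `import` lines (`…HodgeFermatCorollaryUPrime` for `import HodgeFermat.CorollaryUPrime`,
`…HodgeFermatLemmaWk` for `import HodgeFermat.LemmaWk`); this docstring (replacing the module docstring, quoted below); one one-line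
docstring added (gate lint) to `evenAtK_mono`; TWO DEDUP deletions (pre-empting the gate's `dedup.landed`; both are the source's own
«is the case k = 6» re-derivations, used nowhere): `theorem evenAt_of_lemmaW'` (source l.140–142) restates
`HodgeFermat.KRFree.CorollaryUPrime.evenAt_of_lemmaW` and `theorem corUPrime_of'` (source l.248–250) restates
`HodgeFermat.KRFree.CorollaryUPrime.corUPrime_of` (both in `HodgeFermatCorollaryUPrime.lean`).  Every other line — in particular every
declaration's statement and proof — is byte-identical to the source.
Trust base: hypotheses displayed, no `sorry`; axioms = [propext, Classical.choice, Quot.sound].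
HONEST FRAMING: explicit algebraic cycles for specific Hodge classes on Fermat/Delsarte varieties; residual open instances
listed; no claim on general Hodge.  (This file is arithmetic of CM types / finite combinatorics of the sibling's KR-free
programme; it claims nothing about cycles.)

The docstring of `HodgeFermat/CorollaryUSharp.lean` (l.7–29), verbatim:

## COROLLARY U′ with a VARIABLE threshold — the multiset side (HF-G27b)

`CorollaryUPrime.lean` derives COROLLARY U′ of `tables/SEMI-THEOREM.md` §2 with the uniform threshold `6` (at most six
distinct residues) from LEMMA W with its support bound `12`.  The printed corollary has the level-dependent threshold
`#supp(v) < 1/s(m)` (and `< 1/U(m) ≍ log m`): "as above with `w = v`: `supp ŵ⁻ ⊂` bad odd characters,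
`#supp w⁻ ≤ 2·#supp v`, uncertainty principle ⟹ `w⁻ = 0`".  This module is the SAME derivation with the threshold a
parameter `k`, from LEMMA W_k (`LemmaWSupp.LemmaWk N (2k)`: odd weights on the units with support `≤ 2k` and vanishing
residue transform are zero):

* `evenAtK_of_lemmaWk : 1 < N → LemmaWk N (2 * k) → EvenAtK N k` — WEIGHT form: an integer weight on the units mod `N`
  with at most `k` non-zero values satisfying the Hodge length equations `2 Σ_x v(x)⟨tx⟩ = N Σ_x v(x)` at every unit is
  EVEN (`EvenAtK N 6` is `CorollaryUPrime.EvenAt N` on the nose);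
* `count_neg_eq_count_of_lemmaWk`, `isSumOfPairs_of_lemmaWk` — MULTISET form: an all-unit Hodge multiset over `ℤ/N`
  (`IsHodgeMultiset`, vendored `Literature`) with at most `k` distinct entries is a sum of pairs `{a, −a}` (`N` odd);
* `isSumOfPairs_odd` — the same packaged for every odd `N` (`N = 1` is vacuous), the form fed by the analytic
  thresholds in `CorollaryUSharpFinal.lean`: `2·k·#bad(N) < φ(N)` (i.e. `k < 1/s(N)`) and `k·Σ_p τ⁺(N,p) < φ(N)`
  (i.e. `k < 1/U(N)`), via `LemmaWkFourier.lemmaWk_of_badCount`;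
* `corUPrime_of'` — generation 27's `CorUPrime` (threshold 6 at odd `N ∉ {21, 39}`) re-derived as the instance `k = 6`.

Hub record `check/CorUSharp_standalone.lean` (`--axioms HodgeFermat.KRFree.CorollaryUSharp.isSumOfPairs_odd` = the
three); link check `check/CorUSharpLink_standalone.lean`.  Paper §1 (xiv); `tables/SEMI-THEOREM.md` §2.
-/

set_option autoImplicit false

namespace HodgeFermat.KRFree.CorollaryUSharp

open Finset HodgeFermat.KRFree.LemmaN HodgeFermat.KRFree.TheoremU HodgeFermat.KRFree.LemmaWSupp
open HodgeFermat.KRFree.CorollaryUPrime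
open Literature.AlgebraicGeometry.HodgeTheory.FermatCharacter

/-! ## Statements -/

/-- COROLLARY U′ at level `N`, WEIGHT form with threshold `k`: an integer weight on the units of `ℤ/N` (zero off
`[0, N)` and off the units), with at most `k` non-zero values, which satisfies the Hodge length equations
`2 Σ_x v(x)⟨tx⟩_N = N Σ_x v(x)` at every unit `t`, is even: `v(N − x) = v(x)`. -/
def EvenAtK (N k : ℕ) : Prop :=
  ∀ v : ℕ → ℤ,
    (∀ x, N ≤ x → v x = 0) →
    (∀ x, ¬ Nat.Coprime x N → v x = 0) →
    ((Finset.range N).filter (fun x => v x ≠ 0)).card ≤ k →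
    (∀ t, Nat.Coprime t N → 2 * resTransform N v t = (N : ℤ) * ∑ x ∈ Finset.range N, v x) →
    ∀ x, x < N → v (N - x) = v x

/-- `EvenAtK N 6` is literally generation 27's `EvenAt N`. -/
theorem evenAtK_six_iff (N : ℕ) : EvenAtK N 6 ↔ EvenAt N := Iff.rfl

/-- monotonicity in the threshold -/
theorem evenAtK_mono {N k k' : ℕ} (hk : k ≤ k') (h : EvenAtK N k') : EvenAtK N k :=
  fun v h1 h2 h3 h4 => h v h1 h2 (h3.trans hk) h4

/-! ## The weight form from LEMMA W_{2k} -/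

/-- **COROLLARY U′, weight form with threshold `k`, from LEMMA W_{2k} at `N > 1`.** -/
theorem evenAtK_of_lemmaWk {N k : ℕ} (h1 : 1 < N) (hW : LemmaWk N (2 * k)) : EvenAtK N k := by
  intro v hvN hvu hcard hH
  have hN : 0 < N := by omega
  have hv0 : v 0 = 0 := hvu 0 (by intro h; rw [Nat.coprime_zero_left] at h; omega)
  -- LEMMA W_{2k} applied to the odd part `w = v − v(N − ·)`
  have hwN : ∀ y, N ≤ y → oddPart N v y = 0 := by
    intro y hy
    simp only [oddPart, hvN y hy, Nat.sub_eq_zero_of_le hy, hv0, sub_zero]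
  have hwu : ∀ y, ¬ Nat.Coprime y N → oddPart N v y = 0 := by
    intro y hy
    have h2 : v (N - y) = 0 := by
      rcases Nat.lt_or_ge y N with hlt | hge
      · refine hvu _ fun hc => hy ?_
        have := coprime_sub (Nat.sub_le N y) hc
        rwa [Nat.sub_sub_self hlt.le] at this
      · rw [Nat.sub_eq_zero_of_le hge, hv0]
    simp only [oddPart, hvu y hy, h2, sub_zero]
  have hwodd : ∀ y, 0 < y → y < N → oddPart N v (N - y) = - oddPart N v y := by
    intro y _ hy
    simp only [oddPart, Nat.sub_sub_self hy.le]
    ring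
  have hwcard : ((Finset.range N).filter (fun y => oddPart N v y ≠ 0)).card ≤ 2 * k := by
    set S := (Finset.range N).filter (fun x => v x ≠ 0) with hS
    have hsub : (Finset.range N).filter (fun y => oddPart N v y ≠ 0) ⊆ S ∪ S.image (fun x => N - x) := by
      intro y hy
      rw [Finset.mem_filter, Finset.mem_range] at hy
      rw [Finset.mem_union]
      by_cases hvy : v y = 0
      · right
        have hvy' : v (N - y) ≠ 0 := by
          intro h0; apply hy.2; simp only [oddPart, hvy, h0, sub_zero]
        have hy0 : 0 < y := by
          rcases Nat.eq_zero_or_pos y with rfl | h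
          · exact absurd (by rw [Nat.sub_zero]; exact hvN N le_rfl) hvy'
          · exact h
        refine Finset.mem_image.mpr ⟨N - y, Finset.mem_filter.mpr ⟨Finset.mem_range.mpr (by omega), hvy'⟩, ?_⟩
        exact Nat.sub_sub_self hy.1.le
      · exact Or.inl (Finset.mem_filter.mpr ⟨Finset.mem_range.mpr hy.1, hvy⟩)
    calc ((Finset.range N).filter (fun y => oddPart N v y ≠ 0)).card
        ≤ (S ∪ S.image (fun x => N - x)).card := Finset.card_le_card hsub
      _ ≤ S.card + (S.image (fun x => N - x)).card := Finset.card_union_le _ _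
      _ ≤ S.card + S.card := Nat.add_le_add_left Finset.card_image_le _
      _ ≤ 2 * k := by have : S.card ≤ k := hcard; omega
  have hwT : ∀ t, Nat.Coprime t N → resTransform N (oddPart N v) t = 0 := by
    intro t ht
    -- `Σ_y v(N − y)⟨ty⟩ = Σ_y v(y)⟨t(N − y)⟩ = Σ_y v(y)(N − ⟨ty⟩)` (the last because `v` lives on the units)
    have hrefl := sum_reflect v (fun y => ((t * y % N : ℕ) : ℤ)) hv0 (hvN N le_rfl)
    have hneg : ∀ y ∈ Finset.range N,
        v y * ((t * (N - y) % N : ℕ) : ℤ) = v y * ((N : ℤ) - ((t * y % N : ℕ) : ℤ)) := by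
      intro y hy
      have hy' := Finset.mem_range.mp hy
      by_cases hvy : v y = 0
      · rw [hvy, zero_mul, zero_mul]
      · have hyu : Nat.Coprime y N := by by_contra hc; exact hvy (hvu y hc)
        have hres : ((t * (N - y) % N : ℕ) : ℤ) + ((t * y % N : ℕ) : ℤ) = (N : ℤ) := by
          exact_mod_cast neg_res hN hy'.le (not_dvd_of_coprime h1 (Nat.coprime_mul_iff_left.mpr ⟨ht, hyu⟩))
        congr 1
        linarith
    have eT : ∑ y ∈ Finset.range N, v y * ((N : ℤ) - ((t * y % N : ℕ) : ℤ))
        = (N : ℤ) * (∑ y ∈ Finset.range N, v y) - ∑ y ∈ Finset.range N, v y * ((t * y % N : ℕ) : ℤ) := by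
      rw [Finset.mul_sum, ← Finset.sum_sub_distrib]
      exact Finset.sum_congr rfl fun y _ => by ring
    have key : resTransform N (oddPart N v) t
        = 2 * resTransform N v t - (N : ℤ) * ∑ y ∈ Finset.range N, v y := by
      unfold resTransform
      have step : ∑ y ∈ Finset.range N, oddPart N v y * ((t * y % N : ℕ) : ℤ)
          = ∑ y ∈ Finset.range N, v y * ((t * y % N : ℕ) : ℤ) - ∑ y ∈ Finset.range N, v (N - y) * ((t * y % N : ℕ) : ℤ) := by
        rw [← Finset.sum_sub_distrib]
        exact Finset.sum_congr rfl fun y _ => by simp only [oddPart]; ring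
      rw [step, hrefl, Finset.sum_congr rfl hneg, eT]
      ring
    rw [key, hH t ht]
    ring
  have hzero := hW (oddPart N v) hwN hwu hwodd hwcard hwT
  intro x _
  have hx := hzero x
  simp only [oddPart] at hx
  linarith

-- `theorem evenAt_of_lemmaW'` (source l.140–142, «generation 27's `evenAt_of_lemmaW` is the case `k = 6`»): NOT re-declared —
-- its statement is `HodgeFermat.KRFree.CorollaryUPrime.evenAt_of_lemmaW` of `HodgeFermatCorollaryUPrime.lean` (DEDUP).

/-! ## The multiset form -/

/-- **COROLLARY U′, multiset form with threshold `k`, from LEMMA W_{2k} at `N > 1`**: an all-unit Hodge multiset with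
at most `k` distinct entries takes every value as often as its negative. -/
theorem count_neg_eq_count_of_lemmaWk {N k : ℕ} (h1 : 1 < N) (hW : LemmaWk N (2 * k)) {s : Multiset (ZMod N)}
    (hs : IsHodgeMultiset s) (hu : ∀ a ∈ s, IsUnit a) (hk : s.toFinset.card ≤ k) (a : ZMod N) :
    s.count (-a) = s.count a := by
  haveI : NeZero N := ⟨by omega⟩
  -- the multiplicity weight satisfies the hypotheses of the weight form
  have hv0 : ∀ x, N ≤ x → cw s x = 0 := fun x hx => cw_of_le s hx
  have hvu : ∀ x, ¬ Nat.Coprime x N → cw s x = 0 := by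
    intro x hx
    rcases Nat.lt_or_ge x N with hlt | hge
    · rw [cw_of_lt s hlt, Nat.cast_eq_zero]
      exact Multiset.count_eq_zero.mpr fun hmem => hx ((ZMod.isUnit_iff_coprime x N).mp (hu _ hmem))
    · exact cw_of_le s hge
  have hcard : ((Finset.range N).filter (fun x => cw s x ≠ 0)).card ≤ k := by
    refine le_trans ?_ hk
    refine Finset.card_le_card_of_injOn (fun x : ℕ => (x : ZMod N)) ?_ ?_
    · intro x hx
      rw [Finset.mem_coe, Finset.mem_filter, Finset.mem_range] at hx
      rw [Finset.mem_coe, Multiset.mem_toFinset]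
      have hne : s.count (x : ZMod N) ≠ 0 := by
        have h := hx.2
        rwa [cw_of_lt s hx.1, Nat.cast_ne_zero] at h
      exact Multiset.count_ne_zero.mp hne
    · intro x hx y hy hxy
      rw [Finset.mem_coe, Finset.mem_filter, Finset.mem_range] at hx hy
      have h := (ZMod.natCast_eq_natCast_iff' x y N).mp hxy
      rwa [Nat.mod_eq_of_lt hx.1, Nat.mod_eq_of_lt hy.1] at h
  have hH : ∀ t, Nat.Coprime t N →
      2 * resTransform N (cw s) t = (N : ℤ) * ∑ x ∈ Finset.range N, cw s x := by
    intro t ht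
    have h := hs.2 (ZMod.unitOfCoprime t ht)
    rw [ZMod.coe_unitOfCoprime] at h
    -- `h : 2 * mNormSum (s.map (t * ·)) = N * #s` in `ℕ`; both sides are the two sides of the claim
    have e1N : mNormSum (s.map fun a => (t : ZMod N) * a)
        = ∑ x ∈ Finset.range N, s.count (x : ZMod N) * (t * x % N) := by
      unfold mNormSum
      rw [Multiset.map_map, sum_map_eq_sum_count_mul, sum_zmod_eq_sum_range]
      refine Finset.sum_congr rfl fun x _ => ?_
      rw [Function.comp_apply, ← Nat.cast_mul, ZMod.val_natCast]
    have e1 : ((mNormSum (s.map fun a => (t : ZMod N) * a) : ℕ) : ℤ) = resTransform N (cw s) t := by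
      rw [e1N, Nat.cast_sum]
      unfold resTransform
      refine Finset.sum_congr rfl fun x hx => ?_
      rw [cw_of_lt s (Finset.mem_range.mp hx), Nat.cast_mul]
    have e2 : ((Multiset.card s : ℕ) : ℤ) = ∑ x ∈ Finset.range N, cw s x := by
      rw [card_eq_sum_count, Nat.cast_sum, sum_zmod_eq_sum_range]
      exact Finset.sum_congr rfl fun x hx => by rw [cw_of_lt s (Finset.mem_range.mp hx)]
    have h' : (2 : ℤ) * ((mNormSum (s.map fun a => (t : ZMod N) * a) : ℕ) : ℤ)
        = (N : ℤ) * ((Multiset.card s : ℕ) : ℤ) := by exact_mod_cast h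
    rw [e1, e2] at h'
    exact h'
  have heven := evenAtK_of_lemmaWk h1 hW (cw s) hv0 hvu hcard hH
  -- read off the multiplicities of `a` and `−a`
  by_cases ha0 : a = 0
  · rw [ha0, neg_zero]
  · have hx : a.val < N := ZMod.val_lt a
    have hpos : 0 < a.val := by
      rcases Nat.eq_zero_or_pos a.val with h | h
      · exact absurd ((ZMod.val_eq_zero a).mp h) ha0
      · exact h
    have key := heven a.val hx
    rw [cw_of_lt s (by omega : N - a.val < N), cw_of_lt s hx, Nat.cast_inj, ZMod.natCast_zmod_val] at key
    have e : ((N - a.val : ℕ) : ZMod N) = -a := by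
      rw [Nat.cast_sub hx.le, ZMod.natCast_self, ZMod.natCast_zmod_val, zero_sub]
    rw [e] at key
    exact key

/-! ## COROLLARY U′ with threshold `k` -/

/-- **COROLLARY U′ with threshold `k` at an odd level `N > 1` where LEMMA W_{2k} holds**: an all-unit Hodge multiset
with at most `k` distinct residues is a sum of pairs `{a, −a}`. -/
theorem isSumOfPairs_of_lemmaWk {N k : ℕ} (h1 : 1 < N) (hodd : ¬ 2 ∣ N) (hW : LemmaWk N (2 * k))
    {s : Multiset (ZMod N)} (hs : IsHodgeMultiset s) (hu : ∀ a ∈ s, IsUnit a) (hk : s.toFinset.card ≤ k) :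
    IsSumOfPairs s := by
  haveI : NeZero N := ⟨by omega⟩
  exact isSumOfPairs_of_count hodd (Multiset.card s) s le_rfl hs (count_neg_eq_count_of_lemmaWk h1 hW hs hu hk)

/-- **The same at every odd level** (`N = 1`: every residue is `0`, a Hodge multiset is empty) — the hub-checked
content of this module; the analytic thresholds of `CorollaryUSharpFinal.lean` supply the hypothesis. -/
theorem isSumOfPairs_odd (N k : ℕ) (hodd : ¬ 2 ∣ N) (hW : 1 < N → LemmaWk N (2 * k))
    {s : Multiset (ZMod N)} (hs : IsHodgeMultiset s) (hu : ∀ a ∈ s, IsUnit a) (hk : s.toFinset.card ≤ k) :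
    IsSumOfPairs s := by
  rcases Nat.lt_or_ge 1 N with h1 | hN1
  · exact isSumOfPairs_of_lemmaWk h1 hodd (hW h1) hs hu hk
  · have hN : N = 1 := by
      rcases Nat.eq_zero_or_pos N with rfl | hpos
      · exact absurd (dvd_zero 2) hodd
      · omega
    subst hN
    have hs0 : s = 0 := by
      rcases Multiset.empty_or_exists_mem s with h | ⟨a, ha⟩
      · exact h
      · exact absurd ((ZMod.val_eq_zero a).mp (by have := ZMod.val_lt a; omega)) (hs.1.1 a ha)
    exact ⟨0, fun a ha => by simp at ha, by simp [hs0]⟩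

/-- … hence ℤ-reachable from the printed supply of its level (pairs only). -/
theorem reach_odd (N k : ℕ) (hodd : ¬ 2 ∣ N) (hW : 1 < N → LemmaWk N (2 * k))
    {s : Multiset (ZMod N)} (hs : IsHodgeMultiset s) (hu : ∀ a ∈ s, IsUnit a) (hk : s.toFinset.card ≤ k) :
    Reach N s :=
  reach_of_isSumOfPairs (isSumOfPairs_odd N k hodd hW hs hu hk)

-- `theorem corUPrime_of'` (source l.248–250, «generation 27's COROLLARY U′ with threshold 6 is the instance `k = 6`»): NOT
-- re-declared — its statement is `HodgeFermat.KRFree.CorollaryUPrime.corUPrime_of` of `HodgeFermatCorollaryUPrime.lean` (DEDUP).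

end HodgeFermat.KRFree.CorollaryUSharp
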